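import Summits.Langlands.Langlands.Theses.ExteriorSquareAscent
import Literature.NumberTheory.Automorphic.PairLFunctionPolesRepDataOfHumphriesJo
import Literature.NumberTheory.Automorphic.PairLFunctionPolesEqConjLowerBound

/-!
# SkelVet facts — stmt-Langlands-19093 `PairLPoleJS` (route-Langlands-ExteriorSquareAscent)

Everything in this file is expected to ELABORATE (rc 0, no sorry).  It records, for the re-vet of a
future registered skeleton `Cruxes/PairLPoleJS/Lines/birth.lean`:

* `pairLPoleJS_iff_fact` — the crux IS the named fact `JacquetShalika1981_partialPairL_pole_repData`
  (`Iff.rfl`);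
* three "Literature-level" candidate stubs `T_HJ`, `T_L2`, `T_LB` (the hypotheses of the in-tree
  conditional proofs of the fact) EACH imply the crux by a ONE-LINE TERM built from landed theorems —
  so a skeleton whose stub set contains any one of them has exactly ONE load-bearing stub (the other
  `stub_*` would be decoration), even though the hammer probe `first | exact? | simpa | aesop` need not
  see it (the route decl `PairLPoleJS` is a plain `def`, opaque to the discrimination tree); see
  `SkelVetProbes.lean` for the hammer runs.
-/

set_option linter.dupNamespace false

noncomputable section

open Filter Topology MeasureTheory Set NumberField IsDedekindDomain

namespace Summit.Langlands.Langlands.Cruxes.PairLPoleJS.SkelVet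

open Summit.Langlands.Langlands.Theses.ExteriorSquareAscent (PairLPoleJS)
open Literature.NumberTheory.Automorphic
open Literature.NumberTheory.Automorphic.AdelicGroupData

-- the automorphic quotient carries the tree's Borel σ-algebra, not Mathlib's quotient σ-algebra
attribute [-instance] Quotient.instMeasurableSpace QuotientGroup.measurableSpace

/-- The crux is the named fact, definitionally. -/
theorem pairLPoleJS_iff_fact : PairLPoleJS ↔ JacquetShalika1981_partialPairL_pole_repData := Iff.rfl

/-- Candidate stub 1: Humphries–Jo archimedean test vectors in ranks `≥ 3` (a named, unproved fact). -/
def T_HJ : Prop :=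
  ∀ (N : ℕ) (K : Type) [Field K] [NumberField K], 3 ≤ N → HumphriesJo2024_archRankinSelberg_testVector N K

/-- Candidate stub 2: the `L²` leaf (2.3) in ranks `≥ 3`, every field, every automorphic measure. -/
def T_L2 : Prop :=
  ∀ (n : ℕ) (K : Type) [Field K] [NumberField K] (μ : Measure (gl n K).automorphicQuotient)
    [(gl n K).IsAutomorphicMeasure μ], 3 ≤ n →
      JacquetShalika1981_partialPairL_pole_of_eq_conj (n := n) (K := K) (μ := μ)

/-- Candidate stub 3: the one-sided real lower bound `liminf (σ-1)‖L^{S'}(σ, β ⊗ β̄)‖ > 0` in ranks `≥ 3`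
(the hypothesis of `JacquetShalika1981_partialPairL_pole_of_eq_conj_of_lower_bound`; the target of
idea card `mirabolic-slice-deaveraging`). -/
def T_LB : Prop :=
  ∀ (n : ℕ) (K : Type) [Field K] [NumberField K] (μ' : Measure (gl n K).automorphicQuotient)
    [(gl n K).IsAutomorphicMeasure μ'], 3 ≤ n →
      ∀ (P : CuspidalAutomorphicRepGL n K μ') (S' : Set (HeightOneSpectrum (𝓞 K))), S'.Finite →
        ∀ (β : SatakeFamily K), IsSatakeFamilyOf P S' β →
          ∃ c : ℝ, 0 < c ∧ ∀ᶠ σ : ℝ in 𝓝[>] 1, c ≤ (σ - 1) * ‖partialPairL S' β (conjFamily β) (σ : ℂ)‖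

/-- `T_HJ` alone gives the crux (one landed theorem). -/
theorem pairLPoleJS_of_T_HJ : T_HJ → PairLPoleJS :=
  fun h => JacquetShalika1981_partialPairL_pole_repData_of_humphriesJo_three_le h

/-- `T_L2` alone gives the crux (two landed theorems). -/
theorem pairLPoleJS_of_T_L2 : T_L2 → PairLPoleJS :=
  fun h => JacquetShalika1981_partialPairL_pole_repData_of_rank_three_le
    fun n F _ _ hF h3 π π' =>
      JacquetShalika1981_partialPairL_pole_repData_rank (fun μ _ => h n F μ h3) hF (by omega) π π'

/-- `T_LB` alone gives the crux (three landed theorems). -/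
theorem pairLPoleJS_of_T_LB : T_LB → PairLPoleJS :=
  fun h => JacquetShalika1981_partialPairL_pole_repData_of_rank_three_le
    fun n F _ _ hF h3 π π' =>
      JacquetShalika1981_partialPairL_pole_repData_rank
        (fun μ _ => JacquetShalika1981_partialPairL_pole_of_eq_conj_of_lower_bound (h n F μ h3))
        hF (by omega) π π'

/-- Converse bookkeeping: crux → ranks `≥ 3` of the fact (specialisation through the iff). -/
theorem fact_rank_three_le_of_pairLPoleJS (h : PairLPoleJS) :
    ∀ (n : ℕ) (F : Type) [Field F] [NumberField F] (hF : isCompact_glFiniteIntegralLevel n F),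
      3 ≤ n → ∀ (π π' : CuspidalAutomorphicRepData n F hF),
      ∃ S₀ : Set (HeightOneSpectrum (𝓞 F)), S₀.Finite ∧
        ∀ {S : Set (HeightOneSpectrum (𝓞 F))} (_hS : S.Finite) (_hS₀ : S₀ ⊆ S)
          {α β : SatakeFamily F} (_hα : ∀ w ∉ S, π.1.HasSatakeParamAt w (α w))
          (_hβ : ∀ w ∉ S, π'.1.HasSatakeParamAt w (β w))
          (_hu : ∀ w ∉ S, ‖(α w).prod‖ = 1) (_hu' : ∀ w ∉ S, ‖(β w).prod‖ = 1)
          {s₀ : ℂ} (_hs₀ : s₀.re = 1)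
          (_hX : ∀ᶠ w in cofinite,
            (α w).map (((w.residueCard : ℂ) ^ (1 - s₀)) * ·) = (β w).map (·⁻¹)),
          ∃ c : ℂ, c ≠ 0 ∧
            Tendsto (fun s => (s - s₀) * partialPairL S α β s) (𝓝[{s : ℂ | 1 < s.re}] s₀) (𝓝 c) :=
  JacquetShalika1981_partialPairL_pole_repData_iff_rank_three_le.mp (pairLPoleJS_iff_fact.mp h)

end Summit.Langlands.Langlands.Cruxes.PairLPoleJS.SkelVet

end
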